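import Summits.Langlands.Langlands.Theorems.PhantomRMYoshidaResiduallyYoshidaLiftingNonsplitCommutant
import Literature.NumberTheory.GaloisRepresentations.SymplecticMultiplier
import HarnessLib

/-!
# The multiplier of a symplectic realiser is residually forced (stub `stub_realiserMultiplierResidual`) — line `sector-klingen-split`

Stub-worker of lead prover-line-stmt-Langlands-13639-c3-0 (wave 2, 2026-08-17), skeleton rev 5 (anchor R1c-K lets the multiplier `ν` of
the anchor be ANY function; this file shows the freedom is residually nil).  Let `r : Γ_ℚ → GL₄(ℚ̄_p)` be symplectic with multiplier
`ν` (`rᵀ J r = ν J`, `Jᵀ = -J`, `det J ≠ 0`) and realise `(σ̄, B; 0, σ̄')` through an integral frame (`B` arbitrary), with `σ̄, σ̄'`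
irreducible of equal determinant and `σ̄'` NOT a pointwise-scalar twist of a conjugate of `σ̄`.  Then `ν` is a `p`-adic unit and its
reduction is `det σ̄'`: rescale `Pᵀ J P` to an integral antisymmetric `J''` with an entry `1`; its reduction `J̄ ≠ 0` satisfies
`ρ̄ᵀ J̄ ρ̄ = ν̄ J̄`; in the block frame, `J̄ = (aJ₂, J₁₂; -J₁₂ᵀ, bJ₂)`: if `a ≠ 0` then `ν̄ = det σ̄`; else `J₁₂` intertwines
`σ̄' → ν̄ ⊗ σ̄^{-T} ≅ σ̄ ⊗ (ν̄ / det σ̄)`, so it is `0` (else a twist) and then `b ≠ 0`, `ν̄ = det σ̄'`.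
-/

noncomputable section

open scoped MatrixGroups Valued

set_option linter.dupNamespace false
set_option autoImplicit false

open Matrix

open Literature.NumberTheory.GaloisRepresentations

namespace Summit.Langlands.Langlands.Cruxes.ResiduallyYoshidaLifting.SectorKlingenSplit.Ribet

open Summit.Langlands.Langlands.Cruxes.ResiduallyYoshidaLifting.EndoscopicCrossingEuler

/-! ### `2 × 2` facts about the alternating plane form `J₂ = !![0, 1; -1, 0]` (always written out) -/

section TwoByTwo

variable {k : Type*} [Field k]

/-- In characteristic `≠ 2`, a `2 × 2` matrix with `Mᵀ = -M` is a multiple of `J₂`. [folklore] -/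
theorem eq_smul_J₂_of_transpose_eq_neg (h2 : (2 : k) ≠ 0) (M : Matrix (Fin 2) (Fin 2) k)
    (hM : Mᵀ = -M) : M = M 0 1 • !![(0 : k), 1; -1, 0] := by
  have h : ∀ i j, M j i = -M i j := fun i j => by
    have e := congrFun (congrFun hM i) j
    rwa [Matrix.transpose_apply, Matrix.neg_apply] at e
  have hd : ∀ i, M i i = 0 := fun i => by
    have e : M i i + M i i = 0 := eq_neg_iff_add_eq_zero.mp (h i i)
    rwa [← two_mul, mul_eq_zero, or_iff_right h2] at e
  ext i j
  fin_cases i <;> fin_cases j <;> simp [hd, h 0 1]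

/-- `Aᵀ (a J₂) A = (a det A) J₂` for every `2 × 2` matrix `A` (`GL₂ = GSp₂`). [folklore] -/
theorem transpose_mul_smul_J₂_mul (A : Matrix (Fin 2) (Fin 2) k) (a : k) :
    Aᵀ * (a • !![(0 : k), 1; -1, 0]) * A = (a * A.det) • !![(0 : k), 1; -1, 0] := by
  ext i j
  fin_cases i <;> fin_cases j <;>
    simp [Matrix.mul_apply, Fin.sum_univ_two, Matrix.det_fin_two] <;> ring

/-- `A J₂ Aᵀ = (det A) J₂` for every `2 × 2` matrix `A`. [folklore] -/
theorem mul_J₂_mul_transpose (A : Matrix (Fin 2) (Fin 2) k) :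
    A * !![(0 : k), 1; -1, 0] * Aᵀ = A.det • !![(0 : k), 1; -1, 0] := by
  ext i j
  fin_cases i <;> fin_cases j <;>
    simp [Matrix.mul_apply, Fin.sum_univ_two, Matrix.det_fin_two] <;> ring

/-- `J₂ (J₂ X) = -X` (`J₂² = -1`). [folklore] -/
theorem J₂_mul_J₂_mul (X : Matrix (Fin 2) (Fin 2) k) :
    !![(0 : k), 1; -1, 0] * (!![(0 : k), 1; -1, 0] * X) = -X := by
  have h : !![(0 : k), 1; -1, 0] * !![(0 : k), 1; -1, 0] = -1 := by
    ext i j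
    fin_cases i <;> fin_cases j <;> simp [Matrix.mul_apply]
  rw [← Matrix.mul_assoc, h, Matrix.neg_mul, Matrix.one_mul]

end TwoByTwo

/-! ### Congruence of forms under a change of frame -/

section Congruence

variable {n : Type*} [Fintype n] {R : Type*} [CommRing R]

/-- `(u⁻¹ A u)ᵀ (uᵀ J u) (u⁻¹ A u) = uᵀ (Aᵀ J A) u`: the Gram matrix in the frame `u`. [folklore] -/
theorem transpose_conj_mul_form [DecidableEq n] (u : GL n R) (A J : Matrix n n R) :
    ((u⁻¹).val * A * u.val)ᵀ * (u.valᵀ * J * u.val) * ((u⁻¹).val * A * u.val) =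
      u.valᵀ * (Aᵀ * J * A) * u.val := by
  have h1 : (u⁻¹).valᵀ * u.valᵀ = 1 := by
    rw [← Matrix.transpose_mul, Units.mul_inv, Matrix.transpose_one]
  simp only [Matrix.transpose_mul, Matrix.mul_assoc, Units.mul_inv_cancel_left]
  rw [← Matrix.mul_assoc (u⁻¹).valᵀ, h1, Matrix.one_mul]

/-- Congruence preserves antisymmetry: `(Uᵀ J U)ᵀ = -(Uᵀ J U)` when `Jᵀ = -J`. [folklore] -/
theorem transpose_congr_eq_neg (U J : Matrix n n R) (hJ : Jᵀ = -J) :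
    (Uᵀ * J * U)ᵀ = -(Uᵀ * J * U) := by
  rw [Matrix.transpose_mul, Matrix.transpose_mul, Matrix.transpose_transpose, hJ, Matrix.neg_mul,
    Matrix.mul_neg, Matrix.mul_assoc]

end Congruence

/-! ### Schur-type vanishing of a twisted intertwiner -/

section Schur

variable {k : Type*} [Field k] {Γ : Type*} [Group Γ]

/-- A square matrix whose kernel is stable under an IRREDUCIBLE matrix representation is zero or invertible
(its kernel is a subrepresentation). [folklore] -/
theorem eq_zero_or_isUnit_of_ker_stable {n : ℕ} (τ : Γ →* GL (Fin n) k)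
    (hτ : Representation.IsIrreducible ((glStdRepresentation (Fin n) k).comp τ))
    (T : Matrix (Fin n) (Fin n) k)
    (hT : ∀ x, ∃ M : Matrix (Fin n) (Fin n) k,
      T * ((τ x : GL (Fin n) k) : Matrix (Fin n) (Fin n) k) = M * T) :
    T = 0 ∨ IsUnit T := by
  haveI := hτ
  let W : Subrepresentation ((glStdRepresentation (Fin n) k).comp τ) :=
    { toSubmodule := LinearMap.ker (Matrix.toLin' T)
      apply_mem_toSubmodule := fun g v hv => by
        obtain ⟨M, hM⟩ := hT g
        rw [LinearMap.mem_ker, Matrix.toLin'_apply] at hv ⊢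
        change T *ᵥ (((τ g : GL (Fin n) k) : Matrix (Fin n) (Fin n) k) *ᵥ v) = 0
        rw [Matrix.mulVec_mulVec, hM, ← Matrix.mulVec_mulVec, hv, Matrix.mulVec_zero] }
  rcases IsSimpleOrder.eq_bot_or_eq_top W with hW | hW
  · right
    have hker : LinearMap.ker (Matrix.toLin' T) = ⊥ := congrArg Subrepresentation.toSubmodule hW
    refine Matrix.mulVec_injective_iff_isUnit.mp fun v w hvw => ?_
    exact LinearMap.ker_eq_bot.mp hker (by rw [Matrix.toLin'_apply, Matrix.toLin'_apply]; exact hvw)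
  · left
    have hker : LinearMap.ker (Matrix.toLin' T) = ⊤ := congrArg Subrepresentation.toSubmodule hW
    exact Matrix.toLin'.map_eq_zero_iff.mp (LinearMap.ker_eq_top.mp hker)

/-- **Twisted Schur.**  If `σ' : Γ → GL₂(k)` is irreducible and NOT a pointwise-scalar multiple of a conjugate of
`σ`, every `T` with `det σ(x) • T σ'(x) = c(x) • σ(x) T` for all `x` vanishes: its kernel is `σ'`-stable, so `T` is
`0` or invertible, and an invertible `T` conjugates `σ` into scalar multiples of `σ'`. [folklore] -/
theorem twistedIntertwiner_eq_zero (σ σ' : Γ →* GL (Fin 2) k)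
    (hσ' : Representation.IsIrreducible ((glStdRepresentation (Fin 2) k).comp σ'))
    (hnt : ¬ ∃ u : GL (Fin 2) k, ∀ x, ∃ c : k,
      ((u * σ x * u⁻¹ : GL (Fin 2) k) : Matrix (Fin 2) (Fin 2) k) =
        c • ((σ' x : GL (Fin 2) k) : Matrix (Fin 2) (Fin 2) k))
    (c : Γ → k) (T : Matrix (Fin 2) (Fin 2) k)
    (hT : ∀ x, ((σ x : GL (Fin 2) k) : Matrix (Fin 2) (Fin 2) k).det •
        (T * ((σ' x : GL (Fin 2) k) : Matrix (Fin 2) (Fin 2) k)) =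
      c x • (((σ x : GL (Fin 2) k) : Matrix (Fin 2) (Fin 2) k) * T)) :
    T = 0 := by
  have hd : ∀ x, ((σ x : GL (Fin 2) k) : Matrix (Fin 2) (Fin 2) k).det ≠ 0 := fun x =>
    Matrix.det_ne_zero_of_right_inverse (Units.mul_inv (σ x))
  have hker : ∀ x, ∃ M : Matrix (Fin 2) (Fin 2) k,
      T * ((σ' x : GL (Fin 2) k) : Matrix (Fin 2) (Fin 2) k) = M * T := fun x =>
    ⟨((((σ x : GL (Fin 2) k) : Matrix (Fin 2) (Fin 2) k).det)⁻¹ * c x) •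
        ((σ x : GL (Fin 2) k) : Matrix (Fin 2) (Fin 2) k), by
      rw [Matrix.smul_mul, mul_smul, ← hT x, smul_smul, inv_mul_cancel₀ (hd x), one_smul]⟩
  rcases eq_zero_or_isUnit_of_ker_stable σ' hσ' T hker with h0 | ⟨t, rfl⟩
  · exact h0
  · exfalso
    refine hnt ⟨t⁻¹, fun x => ?_⟩
    by_cases hc : c x = 0
    · exfalso
      have h1 : ((t * σ' x : GL (Fin 2) k) : Matrix (Fin 2) (Fin 2) k) = 0 := by
        have e := hT x
        rw [hc, zero_smul, smul_eq_zero] at e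
        rw [Units.val_mul]
        exact e.resolve_left (hd x)
      have h3 : (1 : Matrix (Fin 2) (Fin 2) k) = 0 := by
        rw [← Units.mul_inv (t * σ' x), h1, Matrix.zero_mul]
      have h4 := congrFun (congrFun h3 0) 0
      simp at h4
    · refine ⟨((σ x : GL (Fin 2) k) : Matrix (Fin 2) (Fin 2) k).det / c x, ?_⟩
      have key : ((σ x : GL (Fin 2) k) : Matrix (Fin 2) (Fin 2) k) * (t : Matrix (Fin 2) (Fin 2) k) =
          (((σ x : GL (Fin 2) k) : Matrix (Fin 2) (Fin 2) k).det / c x) •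
            ((t : Matrix (Fin 2) (Fin 2) k) * ((σ' x : GL (Fin 2) k) : Matrix (Fin 2) (Fin 2) k)) := by
        rw [div_eq_inv_mul, mul_smul, hT x, smul_smul, inv_mul_cancel₀ hc, one_smul]
      rw [inv_inv, Units.val_mul, Units.val_mul, Matrix.mul_assoc, key, Matrix.mul_smul,
        Units.inv_mul_cancel_left]

end Schur

/-! ### The residual multiplier of an invariant alternating form on `(σ, B; 0, σ')` -/

section Residual

variable {k : Type*} [Field k] {Γ : Type*} [Group Γ]

/-- **Residual multiplier, block form.**  Let `σ, σ' : Γ → GL₂(k)` (`2 ≠ 0` in `k`) with `σ'` irreducible,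
`det σ = det σ'`, `σ'` not a pointwise-scalar multiple of a conjugate of `σ`, and let `N ≠ 0` be antisymmetric with
`(σ, B; 0, σ')ᵀ N (σ, B; 0, σ') = ν̄ • N`.  Then `ν̄ = det σ'`: with `N = (a J₂, N₁₂; -N₁₂ᵀ, b J₂)`, block `(1,1)` gives
`a det σ = ν̄ a`; if `a = 0`, `J₂ N₁₂` is a twisted intertwiner hence `0`, and block `(2,2)` gives `b det σ' = ν̄ b` with
`b ≠ 0`. [folklore] -/
theorem multiplier_eq_det_of_blocks (h2 : (2 : k) ≠ 0) (σ σ' : Γ →* GL (Fin 2) k)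
    (hσ' : Representation.IsIrreducible ((glStdRepresentation (Fin 2) k).comp σ'))
    (hdet : ∀ x, ((σ' x : GL (Fin 2) k) : Matrix (Fin 2) (Fin 2) k).det =
      ((σ x : GL (Fin 2) k) : Matrix (Fin 2) (Fin 2) k).det)
    (hnt : ¬ ∃ u : GL (Fin 2) k, ∀ x, ∃ c : k,
      ((u * σ x * u⁻¹ : GL (Fin 2) k) : Matrix (Fin 2) (Fin 2) k) =
        c • ((σ' x : GL (Fin 2) k) : Matrix (Fin 2) (Fin 2) k))
    (B : Γ → Matrix (Fin 2) (Fin 2) k) (νb : Γ → k)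
    (N : Matrix (Fin 2 ⊕ Fin 2) (Fin 2 ⊕ Fin 2) k) (hN0 : N ≠ 0) (hNT : Nᵀ = -N)
    (hN : ∀ x, (Matrix.fromBlocks (σ x).val (B x) 0 (σ' x).val)ᵀ * N *
      Matrix.fromBlocks (σ x).val (B x) 0 (σ' x).val = νb x • N) :
    ∀ x, νb x = ((σ' x : GL (Fin 2) k) : Matrix (Fin 2) (Fin 2) k).det := by
  set N₁₁ := N.toBlocks₁₁
  set N₁₂ := N.toBlocks₁₂
  set N₂₁ := N.toBlocks₂₁
  set N₂₂ := N.toBlocks₂₂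
  have hNb : N = Matrix.fromBlocks N₁₁ N₁₂ N₂₁ N₂₂ := (Matrix.fromBlocks_toBlocks N).symm
  -- antisymmetry of the blocks
  rw [hNb, Matrix.fromBlocks_transpose, Matrix.fromBlocks_neg] at hNT
  obtain ⟨hA11, hA21, -, hA22⟩ := Matrix.fromBlocks_inj.mp hNT
  -- the block equations `(1,1)`, `(1,2)`, `(2,2)`
  have hblk : ∀ x,
      (σ x).valᵀ * N₁₁ * (σ x).val = νb x • N₁₁ ∧
      (σ x).valᵀ * N₁₁ * B x + (σ x).valᵀ * N₁₂ * (σ' x).val = νb x • N₁₂ ∧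
      ((B x)ᵀ * N₁₁ + (σ' x).valᵀ * N₂₁) * B x + ((B x)ᵀ * N₁₂ + (σ' x).valᵀ * N₂₂) * (σ' x).val =
        νb x • N₂₂ := by
    intro x
    have h := hN x
    rw [hNb, Matrix.fromBlocks_transpose, Matrix.fromBlocks_multiply, Matrix.fromBlocks_multiply,
      Matrix.fromBlocks_smul] at h
    obtain ⟨h11, h12, -, h22⟩ := Matrix.fromBlocks_inj.mp h
    simp only [Matrix.transpose_zero, Matrix.zero_mul, Matrix.mul_zero, add_zero] at h11 h12
    exact ⟨h11, h12, h22⟩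
  obtain ⟨a, ha⟩ : ∃ a : k, N₁₁ = a • !![(0 : k), 1; -1, 0] :=
    ⟨_, eq_smul_J₂_of_transpose_eq_neg h2 N₁₁ hA11⟩
  obtain ⟨b, hb⟩ : ∃ b : k, N₂₂ = b • !![(0 : k), 1; -1, 0] :=
    ⟨_, eq_smul_J₂_of_transpose_eq_neg h2 N₂₂ hA22⟩
  by_cases ha0 : a = 0
  · rw [ha0, zero_smul] at ha
    -- block `(1,2)`: `σᵀ N₁₂ σ' = ν̄ N₁₂`, i.e. `J₂ N₁₂` is a twisted intertwiner `σ' → σ`, hence `0`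
    have h12 : ∀ x, (σ x).valᵀ * N₁₂ * (σ' x).val = νb x • N₁₂ := fun x => by
      have h := (hblk x).2.1
      rwa [ha, Matrix.mul_zero, Matrix.zero_mul, zero_add] at h
    have hT0 : !![(0 : k), 1; -1, 0] * N₁₂ = 0 := by
      refine twistedIntertwiner_eq_zero σ σ' hσ' hnt νb _ fun x => ?_
      calc ((σ x : GL (Fin 2) k) : Matrix (Fin 2) (Fin 2) k).det •
            (!![(0 : k), 1; -1, 0] * N₁₂ * ((σ' x : GL (Fin 2) k) : Matrix (Fin 2) (Fin 2) k))
          = (σ x).val * !![(0 : k), 1; -1, 0] * (σ x).valᵀ * N₁₂ * (σ' x).val := by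
            rw [mul_J₂_mul_transpose, Matrix.smul_mul, Matrix.smul_mul]
        _ = (σ x).val * !![(0 : k), 1; -1, 0] * ((σ x).valᵀ * N₁₂ * (σ' x).val) := by
            simp only [Matrix.mul_assoc]
        _ = νb x • (((σ x : GL (Fin 2) k) : Matrix (Fin 2) (Fin 2) k) * (!![(0 : k), 1; -1, 0] * N₁₂)) := by
            rw [h12 x, Matrix.mul_smul, Matrix.mul_assoc]
    have hN12 : N₁₂ = 0 := by
      have e := J₂_mul_J₂_mul N₁₂
      rw [hT0, Matrix.mul_zero] at e
      exact neg_eq_zero.mp e.symm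
    have hN21 : N₂₁ = 0 := by
      rw [← Matrix.transpose_transpose N₂₁, hA21, hN12, neg_zero, Matrix.transpose_zero]
    have hb0 : b ≠ 0 := by
      rintro rfl
      apply hN0
      rw [hNb, ha, hN12, hN21, hb, zero_smul, Matrix.fromBlocks_zero]
    -- block `(2,2)`: `σ'ᵀ (b J₂) σ' = ν̄ b J₂`
    intro x
    have h := (hblk x).2.2
    rw [ha, hN12, hN21, hb] at h
    simp only [Matrix.mul_zero, Matrix.zero_mul, zero_add, add_zero] at h
    rw [transpose_mul_smul_J₂_mul] at h
    have e := congrFun (congrFun h 0) 1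
    simp only [Matrix.smul_apply, smul_eq_mul, Matrix.of_apply, Matrix.cons_val_zero, Matrix.cons_val_one,
      mul_one] at e
    exact mul_right_cancel₀ hb0 (e.symm.trans (mul_comm _ _))
  · -- block `(1,1)`: `σᵀ (a J₂) σ = ν̄ a J₂` with `a ≠ 0`
    intro x
    have h := (hblk x).1
    rw [ha, transpose_mul_smul_J₂_mul] at h
    have e := congrFun (congrFun h 0) 1
    simp only [Matrix.smul_apply, smul_eq_mul, Matrix.of_apply, Matrix.cons_val_zero, Matrix.cons_val_one,
      mul_one] at e
    rw [hdet x]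
    exact mul_right_cancel₀ ha0 (e.symm.trans (mul_comm _ _))

/-- **Residual multiplier, realised form.**  Same conclusion for an antisymmetric `J̄ ≠ 0` with `ρ̄ᵀ J̄ ρ̄ = ν̄ J̄`,
`ρ̄ = h F h⁻¹` and `F` equal to `(σ, B; 0, σ')` in the block coordinates `e`: `ν̄ = det σ'`. [folklore] -/
theorem multiplier_eq_det_of_conj (h2 : (2 : k) ≠ 0) (σ σ' : Γ →* GL (Fin 2) k)
    (hσ' : Representation.IsIrreducible ((glStdRepresentation (Fin 2) k).comp σ'))
    (hdet : ∀ x, ((σ' x : GL (Fin 2) k) : Matrix (Fin 2) (Fin 2) k).det =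
      ((σ x : GL (Fin 2) k) : Matrix (Fin 2) (Fin 2) k).det)
    (hnt : ¬ ∃ u : GL (Fin 2) k, ∀ x, ∃ c : k,
      ((u * σ x * u⁻¹ : GL (Fin 2) k) : Matrix (Fin 2) (Fin 2) k) =
        c • ((σ' x : GL (Fin 2) k) : Matrix (Fin 2) (Fin 2) k))
    (B : Γ → Matrix (Fin 2) (Fin 2) k) (νb : Γ → k) (e : Fin 2 ⊕ Fin 2 ≃ Fin 4)
    (F : Γ → Matrix (Fin 4) (Fin 4) k) (hFb : ∀ x, (F x).submatrix e e = Matrix.fromBlocks (σ x).val (B x) 0 (σ' x).val)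
    (h : GL (Fin 4) k) (Jb : Matrix (Fin 4) (Fin 4) k) (hJ0 : Jb ≠ 0) (hJT : Jbᵀ = -Jb)
    (hJ : ∀ x, (h.val * F x * (h⁻¹).val)ᵀ * Jb * (h.val * F x * (h⁻¹).val) = νb x • Jb) :
    ∀ x, νb x = ((σ' x : GL (Fin 2) k) : Matrix (Fin 2) (Fin 2) k).det := by
  -- move the conjugator onto the form: `J' = hᵀ J̄ h` satisfies `Fᵀ J' F = ν̄ J'`, `J' ≠ 0`, `J'ᵀ = -J'`
  have hF : ∀ x, (F x)ᵀ * (h.valᵀ * Jb * h.val) * F x = νb x • (h.valᵀ * Jb * h.val) := fun x => by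
    have eq := transpose_conj_mul_form h (h.val * F x * (h⁻¹).val) Jb
    have eF : (h⁻¹).val * (h.val * F x * (h⁻¹).val) * h.val = F x := by
      simp only [Matrix.mul_assoc, Units.inv_mul_cancel_left, Units.inv_mul, Matrix.mul_one]
    rw [eF, hJ x, Matrix.mul_smul, Matrix.smul_mul] at eq
    exact eq
  have hJ'0 : h.valᵀ * Jb * h.val ≠ 0 := fun h0 => hJ0 <|
    ((Matrix.isUnit_transpose h.val).mpr h.isUnit).mul_right_eq_zero.mp ((Units.mul_left_eq_zero h).mp h0)
  have hsm : ∀ A C : Matrix (Fin 4) (Fin 4) k, (A * C).submatrix e e = A.submatrix e e * C.submatrix e e :=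
    fun A C => (Matrix.submatrix_mul_equiv A C _ e _).symm
  -- block coordinates
  refine multiplier_eq_det_of_blocks h2 σ σ' hσ' hdet hnt B νb ((h.valᵀ * Jb * h.val).submatrix e e) ?_ ?_ ?_
  · exact fun h0 => hJ'0 (Matrix.ext fun i j => by simpa using congrFun (congrFun h0 (e.symm i)) (e.symm j))
  · rw [Matrix.transpose_submatrix, transpose_congr_eq_neg h.val Jb hJT]
    rfl
  · intro x
    have hh := congrArg (fun X : Matrix (Fin 4) (Fin 4) k => X.submatrix e e) (hF x)
    rw [hsm, hsm, ← Matrix.transpose_submatrix, hFb] at hh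
    exact hh

end Residual

/-! ### Registered form: integral frames of a symplectic `r : Γ_ℚ → GL₄(ℚ̄_p)` -/

/-- **Registered statement `stub_realiserMultiplierResidual`**: the multiplier of a symplectic realiser of `(σ̄, B; 0, σ̄')`
(`σ̄, σ̄'` irreducible, equal determinants, not twists of each other) is a unit with reduction `det σ̄'`. [folklore] -/
theorem stub_realiserMultiplierResidual :
    ∀ (p : ℕ) [Fact p.Prime], p ≠ 2 → ∀ (k : Type) [Field k] [CharP k p] [IsAlgClosed k]
    [TopologicalSpace k] [DiscreteTopology k] (red : Valued.integer (PadicAlgCl p) →+* k)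
    (σ σ' : FramedGaloisRep ℚ k 2) (r : FramedGaloisRep ℚ (PadicAlgCl p) 4)
    (ν : Field.absoluteGaloisGroup ℚ → PadicAlgCl p) (B : Field.absoluteGaloisGroup ℚ → Matrix (Fin 2) (Fin 2) k),
    σ.toGaloisRep.IsIrreducible → σ'.toGaloisRep.IsIrreducible →
    (∀ x, (σ' x).val.det = (σ x).val.det) →
    (¬ ∃ g : GL (Fin 2) k, ∀ x, ∃ c : k, (g * σ x * g⁻¹).val = c • (σ' x).val) →
    r.IsSymplecticWithMultiplierFun ν →
    (∃ (P : GL (Fin 4) (PadicAlgCl p))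
        (rint : Field.absoluteGaloisGroup ℚ →* GL (Fin 4) (Valued.integer (PadicAlgCl p))) (h : GL (Fin 4) k),
        (∀ g, Matrix.GeneralLinearGroup.map (Valued.integer (PadicAlgCl p)).subtype (rint g) = P⁻¹ * r g * P) ∧
        (∀ g, (Matrix.GeneralLinearGroup.map red (rint g)).val =
          h.val * Matrix.reindex finSumFinEquiv finSumFinEquiv
            (Matrix.fromBlocks (σ g).val (B g) 0 (σ' g).val) * (h⁻¹).val)) →
    ∀ x, ∃ u : Valued.integer (PadicAlgCl p), (u : PadicAlgCl p) = ν x ∧ red u = (σ' x).val.det := by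
  intro p _ hp k _ _ _ _ _ red σ σ' r ν B _ hσ' hdet hnt hsymp hframe x
  obtain ⟨J, hJT, hJdet, hJ⟩ := hsymp
  obtain ⟨P, rint, h, hP, hred⟩ := hframe
  have hσ'm : Representation.IsIrreducible ((glStdRepresentation (Fin 2) k).comp σ'.toMonoidHom) := hσ'
  have h2 : (2 : k) ≠ 0 := fun h0 => hp <|
    (Nat.prime_dvd_prime_iff_eq (Fact.out : p.Prime) Nat.prime_two).mp
      ((CharP.cast_eq_zero_iff k p 2).mp (by exact_mod_cast h0))
  -- (1) the frame `rint = P⁻¹ r P` over `ℚ̄_p`; the transported form `J' = Pᵀ J P` is invertible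
  have hPv : ∀ g, ((rint g).val).map (𝒪[PadicAlgCl p]).subtype = (P⁻¹).val * (r g).val * P.val := fun g => by
    have e := congrArg (fun u : GL (Fin 4) (PadicAlgCl p) => (u : Matrix (Fin 4) (Fin 4) (PadicAlgCl p))) (hP g)
    simp only [Units.val_mul] at e
    exact e
  have hJ'u : IsUnit (P.valᵀ * J * P.val) := by
    rw [Matrix.isUnit_iff_isUnit_det, Matrix.det_mul, Matrix.det_mul, Matrix.det_transpose]
    have hPd : IsUnit (P : Matrix (Fin 4) (Fin 4) (PadicAlgCl p)).det := (Matrix.isUnit_iff_isUnit_det _).mp P.isUnit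
    exact (hPd.mul hJdet).mul hPd
  -- (2) integral rescaling `J₀` of `J'` (an entry `1`) and integrality of `ν`: `rintᵀ J₀ rint = ν J₀`
  obtain ⟨q, J₀, i₀, j₀, -, hJ₀, hone⟩ := exists_integral_rescale hJ'u.unit
  rw [IsUnit.unit_spec] at hJ₀
  have hmap : ∀ g, (((rint g).val)ᵀ * J₀ * (rint g).val).map (𝒪[PadicAlgCl p]).subtype =
      ν g • J₀.map (𝒪[PadicAlgCl p]).subtype := fun g => by
    rw [Matrix.map_mul, Matrix.map_mul, Matrix.transpose_map, hJ₀, Matrix.mul_smul, Matrix.smul_mul, hPv g,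
      transpose_conj_mul_form, hJ g, Matrix.mul_smul, Matrix.smul_mul]
    exact smul_comm _ _ _
  obtain ⟨ν₀, hν₀⟩ : ∃ ν₀ : Field.absoluteGaloisGroup ℚ → 𝒪[PadicAlgCl p],
      ∀ g, ((ν₀ g : 𝒪[PadicAlgCl p]) : PadicAlgCl p) = ν g := by
    refine ⟨fun g => (((rint g).val)ᵀ * J₀ * (rint g).val) i₀ j₀, fun g => ?_⟩
    have e := congrFun (congrFun (hmap g) i₀) j₀
    rw [Matrix.map_apply, Matrix.smul_apply, Matrix.map_apply, hone, map_one, smul_eq_mul, mul_one] at e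
    exact e
  have hO : ∀ g, ((rint g).val)ᵀ * J₀ * (rint g).val = ν₀ g • J₀ := fun g => by
    have e : (((rint g).val)ᵀ * J₀ * (rint g).val).map (𝒪[PadicAlgCl p]).subtype =
        (ν₀ g • J₀).map (𝒪[PadicAlgCl p]).subtype := by
      rw [hmap g, Matrix.map_smul' _ _ _ (map_mul (𝒪[PadicAlgCl p]).subtype)]
      congr 1
      exact (hν₀ g).symm
    exact Matrix.map_injective (f := ⇑(𝒪[PadicAlgCl p]).subtype) Subtype.val_injective e
  -- (3) reduce through `red`: `J̄ = red J₀ ≠ 0` is antisymmetric and `ρ̄ᵀ J̄ ρ̄ = red ν₀ • J̄`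
  have hJb0 : J₀.map red ≠ 0 := by
    intro h0
    have e := congrFun (congrFun h0 i₀) j₀
    rw [Matrix.map_apply, hone, map_one, Matrix.zero_apply] at e
    exact one_ne_zero e
  have hJ₀T : J₀ᵀ = -J₀ := by
    have e : J₀ᵀ.map (𝒪[PadicAlgCl p]).subtype = (-J₀).map (𝒪[PadicAlgCl p]).subtype := by
      rw [Matrix.transpose_map, Matrix.map_neg _ (map_neg (𝒪[PadicAlgCl p]).subtype), hJ₀, Matrix.transpose_smul,
        transpose_congr_eq_neg P.val J hJT, smul_neg]
    exact Matrix.map_injective (f := ⇑(𝒪[PadicAlgCl p]).subtype) Subtype.val_injective e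
  have hJbT : (J₀.map red)ᵀ = -J₀.map red := by
    rw [← Matrix.transpose_map, hJ₀T, Matrix.map_neg _ (map_neg red)]
  have hkred : ∀ g, (h.val * Matrix.reindex finSumFinEquiv finSumFinEquiv
        (Matrix.fromBlocks (σ g).val (B g) 0 (σ' g).val) * (h⁻¹).val)ᵀ * J₀.map red *
      (h.val * Matrix.reindex finSumFinEquiv finSumFinEquiv
        (Matrix.fromBlocks (σ g).val (B g) 0 (σ' g).val) * (h⁻¹).val) = red (ν₀ g) • J₀.map red := by
    intro g
    rw [← hred g]
    have e := congrArg (fun X : Matrix (Fin 4) (Fin 4) 𝒪[PadicAlgCl p] => X.map red) (hO g)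
    rw [Matrix.map_mul, Matrix.map_mul, Matrix.transpose_map, Matrix.map_smul' _ _ _ (map_mul red)] at e
    exact e
  have hsub : ∀ g, (Matrix.reindex finSumFinEquiv finSumFinEquiv (Matrix.fromBlocks (σ g).val (B g) 0 (σ' g).val)).submatrix
      ⇑(finSumFinEquiv : Fin 2 ⊕ Fin 2 ≃ Fin (2 + 2)) ⇑(finSumFinEquiv : Fin 2 ⊕ Fin 2 ≃ Fin (2 + 2)) =
      Matrix.fromBlocks (σ g).val (B g) 0 (σ' g).val := fun g => by
    rw [Matrix.reindex_apply, Matrix.submatrix_submatrix, Equiv.symm_comp_self, Matrix.submatrix_id_id]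
  -- (4) the residual algebra
  have hfin := multiplier_eq_det_of_conj h2 σ.toMonoidHom σ'.toMonoidHom hσ'm hdet hnt B (fun g => red (ν₀ g))
    (finSumFinEquiv : Fin 2 ⊕ Fin 2 ≃ Fin (2 + 2))
    (fun g => Matrix.reindex finSumFinEquiv finSumFinEquiv (Matrix.fromBlocks (σ g).val (B g) 0 (σ' g).val))
    hsub h (J₀.map red) hJb0 hJbT hkred
  exact ⟨ν₀ x, hν₀ x, hfin x⟩

end Summit.Langlands.Langlands.Cruxes.ResiduallyYoshidaLifting.SectorKlingenSplit.Ribet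

end
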